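/-
Copyright (c) 2026 the pub-hodgecm-mathlib formalisation cell (harness21).  Prover seat hodgecm-mathlib-K2E4-p10 (g4), Track B ∕ K2-LIT, h413 =
`stmt-HodgeConjecture-24833`, line `K2_E1_TraceFormulaBeta`, campaign «EIS-RANK-ONE» rung R6g («EIS-R6g» proper, brick (R6g-b) of the dealer K2E1-plan (g3)'s STANDING
ORDERS §F g3-v2, 2026-09-04T06:07:54Z ∕ 06:12Z): the Maass–Selberg relation EXTENDS TO THE CLOSURE of the sub-tube — in particular to the DIAGONAL `z′ = z` — by dominated
convergence on the finite-measure automorphic quotient.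
-/
import Summits.HodgeConjecture.HodgeConjecture.Theorems.K2E1TruncatedEisensteinLocallyUniformCMThree   -- ★ p857890 (this seat): (R6g-a) z-locally-uniform `‖Λ^T E(φ,z)‖_∞`
import Summits.HodgeConjecture.HodgeConjecture.Theorems.K2E1MaassSelbergSymmetry                      -- ★ p857832 (this seat): `integral_mul_conj_symm`, the off-diagonal pair
import HarnessLib

/-!
# K2·E1 — `K2E1MaassSelbergDiagonalCMThree`: THE MAASS–SELBERG RELATION ON THE CLOSED SUB-TUBE, INCLUDING THE DIAGONAL `‖Λ^T E(φ, z)‖²_X`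
# (campaign «EIS-RANK-ONE», rung R6g, brick (R6g-b): continuity of `z′ ↦ ⟨Λ^T E(φ,z), Λ^T E(φ′,z′)⟩_X` by dominated convergence on finite-measure `X_G` + limit uniqueness)

Track B ∕ K2-LIT, crux h413 = `stmt-HodgeConjecture-24833`, route of record `HCCMUnconditional`; cell `hodgecm-mathlib`, squad K2, ENGINE E1.  Prover seat
`hodgecm-mathlib-K2E4-p10` (g4); STANDING ORDERS §F g3-v2 of the dealer K2E1-plan (g3) (`TABLE.7th` l. 90), REPORT-FIRST 2026-09-04T06:24Z.  THEOREMS ONLY (no `def`, no `instance`,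
no notation, no named-fact hypothesis, no `sorry`); lane `--supports stmt-HodgeConjecture-24833 --as helper` (count-neutral).  Closes no socket.

THE MATHEMATICS [Arthur1980TraceFormulaII, §4; MoeglinWaldspurger1995, IV.2.3; Garrett2018, §11.3].  The off-diagonal relation ★ p857832 `maassSelberg_truncation_pair_three` holds on
`{Re z′ ≠ Re z}`; at a boundary point `z′₀` (e.g. the diagonal `z′₀ = z`) both sides are limits along the sub-tube `S`: the left side `z′ ↦ ∫_X Λ^T E(φ,z)·conj Λ^T E(φ′,z′) dμ`
by DOMINATED CONVERGENCE on the finite-measure quotient `X_G` (§1: the integrand is bounded by `sup‖Λ^T E(φ,z)‖ · sup_{z′ near z′₀}‖Λ^T E(φ′,z′)‖`, the latter LOCALLY UNIFORM in `z′`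
by ★ (R6g-a), and moves continuously in `z′` pointwise), the right side by continuity of the bracket expression; limits in `ℂ` are unique (§2), so the relation holds at `z′₀`
(§3, hypothesis-first for ANY adelic group datum and ANY relation of record `R`).  §4 specialises to the DIAGONAL of flat sections of `U(J₃)` over the CM pair `(L⁺, L, conj)`:
`∫_X ‖Λ^T E(φ,z)‖² dμ = R(z)` — the Maass–Selberg NORM FORMULA in the shape R7∕R8 consume [MoeglinWaldspurger1995, IV.2.3 and IV.3.8] — with `hΛ′bdd` DISCHARGED by ★ (R6g-a)
p857890 on a compact ball inside `V ∩ {Re > 2}` (modulo the z′-uniform decay `hdec` on `V`), measurability by ★ p857707 + ★ `measurable_quotFun_of_measurable`, `z ∈ closure S` by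
real shifts.  NAMED (honest): `hcont`, the pointwise continuity of `z′ ↦ Λ^T E(φ,z′)(g)` (it rides on the `z′`-continuity of the constant term ∕ the intertwined coefficient
`φ̃_{z′}`, brick (R6g-c)), and the relation of record `hrel` on `S` with its right-hand side `R` (★ p857832 (A) once its per-`z′` inputs are supplied; `R` continuous at
`z′ = z` when `Im z ≠ 0`: `s₂ = 2i·Im z ≠ 0`, `s₁ = 2 Re z − 2 > 0`).
HONEST LABEL: HC_CM is proved only modulo the 7 printed citations (2 remaining named inputs: hLiu418 = `stmt-HodgeConjecture-24832`, h413 = `stmt-HodgeConjecture-24833`) until rung 0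
closes; this file asserts no named fact and closes no socket.
References: [Arthur1980TraceFormulaII] §4 · [MoeglinWaldspurger1995] IV.2.3, IV.3.8 · [Garrett2018] §11.3.
-/

set_option autoImplicit false
-- the mandated namespace repeats the single-problem summit's segment (`HodgeConjecture.HodgeConjecture`)
set_option linter.dupNamespace false

noncomputable section

open MeasureTheory Measure NumberField IsDedekindDomain Set Filter Topology MulAction
open scoped ENNReal NNReal ComplexConjugate
open Literature.NumberTheory.Automorphic Literature.NumberTheory.Automorphic.UnitaryGroup AdelicGroupData
open Summit.HodgeConjecture.HodgeConjecture.Cruxes.H413.K2E1BorelEisensteinU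
open Summit.HodgeConjecture.HodgeConjecture.Cruxes.H413.K2E1TruncatedEisensteinL2
open Summit.HodgeConjecture.HodgeConjecture.Cruxes.H413.K2E1TruncatedEisensteinBoundedCMThree
open Summit.HodgeConjecture.HodgeConjecture.Cruxes.H413.K2E1TruncatedEisensteinLocallyUniformCMThree
open Summit.HodgeConjecture.HodgeConjecture.Cruxes.H413.K2E1MaassSelbergSymmetry

namespace Summit.HodgeConjecture.HodgeConjecture.Cruxes.H413.K2E1MaassSelbergDiagonalCMThree

/-! ## §1 Dominated convergence for the pairing `p ↦ ∫ A·conj (B p)` on a finite measure space -/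

section Dominated

variable {X : Type*} [MeasurableSpace X] {P : Type*} [TopologicalSpace P] [FirstCountableTopology P]

/-- **The pairing `p ↦ ∫_X A·conj (B p) dμ` is continuous (within `S`, at `p₀`) on a FINITE measure space** when `A` is bounded and a.e.-strongly measurable, the `B p` are
a.e.-strongly measurable and UNIFORMLY bounded for `p` near `p₀` in `S`, and `p ↦ B p (x)` is continuous within `S` at `p₀` for a.e. `x` — Mathlib's `continuousWithinAt_of_dominated`
with the constant (integrable) bound `C_A · C_B`. [cite: Arthur1980TraceFormulaII, §4] [cite: MoeglinWaldspurger1995, IV.2.3] -/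
theorem continuousWithinAt_integral_mul_conj_of_bound (μ : Measure X) [IsFiniteMeasure μ] {A : X → ℂ} {B : P → X → ℂ} {S : Set P} {p₀ : P}
    (hAm : AEStronglyMeasurable A μ) {CA : ℝ} (hA : ∀ x, ‖A x‖ ≤ CA)
    (hBm : ∀ᶠ p in 𝓝[S] p₀, AEStronglyMeasurable (B p) μ) {CB : ℝ} (hB : ∀ᶠ p in 𝓝[S] p₀, ∀ x, ‖B p x‖ ≤ CB)
    (hcont : ∀ᵐ x ∂μ, ContinuousWithinAt (fun p => B p x) S p₀) :
    ContinuousWithinAt (fun p => ∫ x, A x * conj (B p x) ∂μ) S p₀ := by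
  refine continuousWithinAt_of_dominated (bound := fun _ => CA * CB) ?_ ?_ (integrable_const _) ?_
  · filter_upwards [hBm] with p hp
    exact hAm.mul (Complex.continuous_conj.comp_aestronglyMeasurable hp)
  · filter_upwards [hB] with p hp
    exact ae_of_all _ fun x => by
      rw [norm_mul, Complex.norm_conj]
      exact mul_le_mul (hA x) (hp x) (norm_nonneg _) ((norm_nonneg _).trans (hA x))
  · filter_upwards [hcont] with x hx
    exact continuousWithinAt_const.mul (Complex.continuous_conj.continuousAt.comp_continuousWithinAt hx)

/-- The left-slot twin: `p ↦ ∫_X (B p)·conj A dμ` is continuous within `S` at `p₀` under the same hypotheses (★ `integral_mul_conj_symm` + continuity of `conj`).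
[cite: Arthur1980TraceFormulaII, §4] -/
theorem continuousWithinAt_integral_mul_conj_of_bound_left (μ : Measure X) [IsFiniteMeasure μ] {A : X → ℂ} {B : P → X → ℂ} {S : Set P} {p₀ : P}
    (hAm : AEStronglyMeasurable A μ) {CA : ℝ} (hA : ∀ x, ‖A x‖ ≤ CA)
    (hBm : ∀ᶠ p in 𝓝[S] p₀, AEStronglyMeasurable (B p) μ) {CB : ℝ} (hB : ∀ᶠ p in 𝓝[S] p₀, ∀ x, ‖B p x‖ ≤ CB)
    (hcont : ∀ᵐ x ∂μ, ContinuousWithinAt (fun p => B p x) S p₀) :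
    ContinuousWithinAt (fun p => ∫ x, B p x * conj (A x) ∂μ) S p₀ := by
  have heq : (fun p => ∫ x, B p x * conj (A x) ∂μ) = fun p => conj (∫ x, A x * conj (B p x) ∂μ) := funext fun p => integral_mul_conj_symm μ _ _
  rw [heq]
  exact Complex.continuous_conj.continuousAt.comp_continuousWithinAt (continuousWithinAt_integral_mul_conj_of_bound μ hAm hA hBm hB hcont)

/-- On the diagonal the pairing is the squared `L²`-norm: `∫ A·conj A dμ = ∫ ‖A‖² dμ` (as a complex number; no integrability needed, both sides junk together). [folklore] -/
theorem integral_mul_conj_self_eq (μ : Measure X) (A : X → ℂ) : ∫ x, A x * conj (A x) ∂μ = ((∫ x, ‖A x‖ ^ 2 ∂μ : ℝ) : ℂ) := by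
  rw [← integral_complex_ofReal]
  refine integral_congr_ae (ae_of_all _ fun x => ?_)
  dsimp only
  rw [Complex.mul_conj, Complex.normSq_eq_norm_sq]

end Dominated

/-! ## §2 Limit uniqueness: two functions that agree on `S` and are continuous within `S` at a point of `closure S` agree there -/

section Closure

variable {P Y : Type*} [TopologicalSpace P] [TopologicalSpace Y] [T2Space Y]

/-- **Agreement on `S` passes to a closure point** where both functions are continuous within `S` (limits along the non-trivial filter `𝓝[S] p₀` are unique in a Hausdorff space).
[folklore] -/
theorem eq_of_eqOn_of_continuousWithinAt {f g : P → Y} {S : Set P} {p₀ : P} (hp₀ : p₀ ∈ closure S)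
    (hf : ContinuousWithinAt f S p₀) (hg : ContinuousWithinAt g S p₀) (h : EqOn f g S) : f p₀ = g p₀ :=
  haveI : (𝓝[S] p₀).NeBot := mem_closure_iff_nhdsWithin_neBot.1 hp₀
  tendsto_nhds_unique_of_eventuallyEq hf hg (eventually_nhdsWithin_of_forall fun _ hx => h hx)

end Closure

/-! ## §3 Any adelic group datum: a relation of record for `⟨Λ, Λ′_p⟩_X` on `S` extends to `closure S` (hypothesis-first) -/

section Quotient

variable {K : Type} [Field K] [NumberField K]
variable {P : Type*} [TopologicalSpace P] [FirstCountableTopology P]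

/-- **THE PAIRING RELATION EXTENDS TO THE CLOSURE OF THE SUB-TUBE** (any adelic group datum `𝒢`, any finite measure `μ` on `𝒢.automorphicQuotient`, any first-countable parameter
space): if `⟨Λ, Λ′_p⟩_X := ∫_X quotFun Λ · conj (quotFun Λ′_p) dμ = R(p)` for all `p ∈ S`, `Λ` is bounded with a.e.-strongly measurable descent, the `Λ′_p` have a.e.-strongly
measurable descents and ONE sup bound for `p` near `p₀` within `S` (★ (R6g-a) currency), `p ↦ Λ′_p(g)` is continuous within `S` at `p₀` for every `g`, and `R` is continuous
within `S` at `p₀ ∈ closure S`, then `⟨Λ, Λ′_{p₀}⟩_X = R(p₀)` (§1 + §2; the descent `quotFun ψ [g] = ψ(g̃⁻¹)` is pointwise in `ψ`).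
[cite: Arthur1980TraceFormulaII, §4] [cite: MoeglinWaldspurger1995, IV.2.3] -/
theorem integral_quotFun_mul_conj_eq_of_closure (𝒢 : AdelicGroupData K) (μ : Measure 𝒢.automorphicQuotient) [IsFiniteMeasure μ]
    {S : Set P} {p₀ : P} (hp₀ : p₀ ∈ closure S)
    {Λ : 𝒢.Adelic → ℂ} (hΛm : AEStronglyMeasurable (𝒢.quotFun Λ) μ) {M : ℝ} (hΛbdd : ∀ g, ‖Λ g‖ ≤ M)
    {Λ' : P → 𝒢.Adelic → ℂ} (hΛ'm : ∀ᶠ p in 𝓝[S] p₀, AEStronglyMeasurable (𝒢.quotFun (Λ' p)) μ)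
    {M' : ℝ} (hΛ'bdd : ∀ᶠ p in 𝓝[S] p₀, ∀ g, ‖Λ' p g‖ ≤ M')
    (hcont : ∀ g : 𝒢.Adelic, ContinuousWithinAt (fun p => Λ' p g) S p₀)
    {R : P → ℂ} (hR : ContinuousWithinAt R S p₀)
    (hrel : ∀ p ∈ S, ∫ x, 𝒢.quotFun Λ x * conj (𝒢.quotFun (Λ' p) x) ∂μ = R p) :
    ∫ x, 𝒢.quotFun Λ x * conj (𝒢.quotFun (Λ' p₀) x) ∂μ = R p₀ := by
  refine eq_of_eqOn_of_continuousWithinAt (f := fun p => ∫ x, 𝒢.quotFun Λ x * conj (𝒢.quotFun (Λ' p) x) ∂μ) hp₀ ?_ hR fun p hp => hrel p hp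
  refine continuousWithinAt_integral_mul_conj_of_bound μ hΛm (AdelicGroupData.norm_quotFun_le hΛbdd) hΛ'm (CB := M') ?_ (ae_of_all _ fun x => hcont _)
  filter_upwards [hΛ'bdd] with p hp
  exact AdelicGroupData.norm_quotFun_le hp

end Quotient

/-! ## §4 The CM pair `(L⁺, L, conj)`, `U(J₃)`: the relation on the DIAGONAL `z′ = z` — `∫_X ‖Λ^T E(φ, z)‖² dμ = R(z)` -/

section Diagonal

variable (L : Type) [Field L] [NumberField L] [IsCMField L]
variable [MeasurableSpace (quasiSplit (↥(maximalRealSubfield L)) L (IsCMField.complexConj L) 3).Adelic]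
  [BorelSpace (quasiSplit (↥(maximalRealSubfield L)) L (IsCMField.complexConj L) 3).Adelic]
  [MeasurableSpace (adelicUnipotent (↥(maximalRealSubfield L)) L (IsCMField.complexConj L) 3)]
  [BorelSpace (adelicUnipotent (↥(maximalRealSubfield L)) L (IsCMField.complexConj L) 3)]

/-- `z` lies in the closure of the sub-tube `{z′ | 2 < Re z′ < Re z}` when `Re z > 2` (real shifts `z − δ`, `δ ↓ 0`). [folklore] -/
theorem mem_closure_subtube {z : ℂ} (hz : 2 < z.re) : z ∈ closure {z' : ℂ | 2 < z'.re ∧ z'.re < z.re} := by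
  refine Metric.mem_closure_iff.2 fun ε hε => ?_
  set δ : ℝ := min (ε / 2) ((z.re - 2) / 2) with hδ
  have hδ0 : 0 < δ := lt_min (half_pos hε) (by linarith)
  have hδε : δ < ε := (min_le_left _ _).trans_lt (half_lt_self hε)
  have hδz : δ < z.re - 2 := (min_le_right _ _).trans_lt (by linarith)
  refine ⟨z - (δ : ℂ), ⟨?_, ?_⟩, ?_⟩
  · rw [Complex.sub_re, Complex.ofReal_re]; linarith
  · rw [Complex.sub_re, Complex.ofReal_re]; linarith
  · rw [Complex.dist_eq, sub_sub_cancel, Complex.norm_real, Real.norm_eq_abs, abs_of_pos hδ0]; exact hδε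

/-- **THE MAASS–SELBERG NORM FORMULA ON THE DIAGONAL, `U(J₃)` OVER THE CM PAIR** (`Re z > 2`, `T ≥ 1`, `φ` continuous, bounded, left-`B(L⁺)`-invariant, `ν` Haar on `N(𝔸)`, `𝓕` a
fundamental domain of `N(L⁺)`, `μ` a finite measure on the automorphic quotient): if the relation of record `⟨Λ^T E(φ,z), Λ^T E(φ,z′)⟩_X = R(z′)` holds on the sub-tube
`2 < Re z′ < Re z` (★ p857832 (A) with its per-`z′` inputs), `R` is continuous within the sub-tube at `z′ = z`, `z′ ↦ Λ^T E(φ,z′)(g)` is continuous there for every `g` (`hcont`,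
named), and the decay `hdec` holds z′-UNIFORMLY on a neighbourhood `V` of `z`, then **`∫_X ‖Λ^T E(φ,z)‖² dμ = R(z)`**.  Discharged inside: the z′-uniform sup bound (★ (R6g-a)
`exists_norm_truncation_eisensteinSeriesU_flatSectionU_le_uniform_cm_three` on a compact ball in `V ∩ {Re > 2}`), the Borel descents (★ p857707 `measurable_truncation_…_cm_three′` +
★ `measurable_quotFun_of_measurable` + ★ `truncation_eisensteinSeriesU_flatSectionU_arithmeticSubgroup_mul`), and `z ∈ closure S`.
[cite: Arthur1980TraceFormulaII, §4] [cite: MoeglinWaldspurger1995, IV.2.3 and IV.3.8] [cite: Garrett2018, §11.3] -/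
theorem maassSelberg_diagonal_flatSectionU_cm_three
    (ν : Measure (adelicUnipotent (↥(maximalRealSubfield L)) L (IsCMField.complexConj L) 3)) [ν.IsHaarMeasure]
    {𝓕 : Set (adelicUnipotent (↥(maximalRealSubfield L)) L (IsCMField.complexConj L) 3)}
    (h𝓕 : IsFundamentalDomain (rationalUnipotent (↥(maximalRealSubfield L)) L (IsCMField.complexConj L) 3) 𝓕 ν) {T : ℝ≥0} (hT : 1 ≤ T)
    {z : ℂ} (hz : 2 < z.re)
    {φ : (quasiSplit (↥(maximalRealSubfield L)) L (IsCMField.complexConj L) 3).Adelic → ℂ} (hφc : Continuous φ) {M : ℝ} (hφM : ∀ x, ‖φ x‖ ≤ M)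
    (hφB : ∀ b ∈ borelU ((IsCMField.complexConj L : L ≃ₐ[↥(maximalRealSubfield L)] L) : L →+* L) ((StdForm.antidiagonal 3).over L),
      ∀ x : (quasiSplit (↥(maximalRealSubfield L)) L (IsCMField.complexConj L) 3).Adelic,
        φ ((quasiSplit (↥(maximalRealSubfield L)) L (IsCMField.complexConj L) 3).toAdelic b * x) = φ x)
    (μ : Measure (quasiSplit (↥(maximalRealSubfield L)) L (IsCMField.complexConj L) 3).automorphicQuotient) [IsFiniteMeasure μ]
    -- the ONE analytic named input of ★ (R6g-a): the decay, z′-uniform on a neighbourhood of `z`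
    {V : Set ℂ} (hV : V ∈ 𝓝 z) {M₁ : ℝ}
    (hdec : ∀ z' ∈ V, ∀ g : (quasiSplit (↥(maximalRealSubfield L)) L (IsCMField.complexConj L) 3).Adelic, T < borelHeight g →
      ‖eisensteinSeriesU (flatSectionU φ z') g - borelConstantTerm ν 𝓕 (eisensteinSeriesU (flatSectionU φ z')) g‖ ≤ M₁)
    -- NAMED: pointwise continuity of the truncation in `z′` from inside the sub-tube (brick (R6g-c))
    (hcont : ∀ g : (quasiSplit (↥(maximalRealSubfield L)) L (IsCMField.complexConj L) 3).Adelic,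
      ContinuousWithinAt (fun z' : ℂ => truncation ν 𝓕 T (eisensteinSeriesU (flatSectionU φ z')) g) {z' : ℂ | 2 < z'.re ∧ z'.re < z.re} z)
    -- the relation of record on the sub-tube and its right-hand side
    {R : ℂ → ℂ} (hR : ContinuousWithinAt R {z' : ℂ | 2 < z'.re ∧ z'.re < z.re} z)
    (hrel : ∀ z' : ℂ, 2 < z'.re → z'.re < z.re →
      ∫ x, (quasiSplit (↥(maximalRealSubfield L)) L (IsCMField.complexConj L) 3).quotFun (truncation ν 𝓕 T (eisensteinSeriesU (flatSectionU φ z))) x *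
          conj ((quasiSplit (↥(maximalRealSubfield L)) L (IsCMField.complexConj L) 3).quotFun (truncation ν 𝓕 T (eisensteinSeriesU (flatSectionU φ z'))) x) ∂μ = R z') :
    ((∫ x, ‖(quasiSplit (↥(maximalRealSubfield L)) L (IsCMField.complexConj L) 3).quotFun (truncation ν 𝓕 T (eisensteinSeriesU (flatSectionU φ z))) x‖ ^ 2 ∂μ : ℝ) : ℂ) = R z := by
  -- a compact ball `Kc ⊆ V ∩ {Re > 2}` around `z`
  obtain ⟨ε, hε, hball⟩ := Metric.mem_nhds_iff.1 hV
  set r : ℝ := min (ε / 2) ((z.re - 2) / 2) with hr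
  have hr0 : 0 < r := lt_min (half_pos hε) (by linarith)
  have hKcV : Metric.closedBall z r ⊆ V := (Metric.closedBall_subset_ball ((min_le_left _ _).trans_lt (half_lt_self hε))).trans hball
  have hKc2 : ∀ z' ∈ Metric.closedBall z r, 2 < z'.re := by
    intro z' hz'
    have hdist : dist z' z ≤ r := Metric.mem_closedBall.1 hz'
    have h1 := Complex.abs_re_le_norm (z' - z)
    rw [Complex.sub_re, ← Complex.dist_eq] at h1
    have h2 := (abs_le.1 (h1.trans hdist)).1
    have h3 : r ≤ (z.re - 2) / 2 := min_le_right _ _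
    linarith
  obtain ⟨M₀, hM₀⟩ := exists_norm_truncation_eisensteinSeriesU_flatSectionU_le_uniform_cm_three L ν h𝓕 hT (isCompact_closedBall z r) hKc2 hφc hφM hφB
    (M₁ := M₁) fun z' hz' g hg => hdec z' (hKcV hz') g hg
  have hKcS : Metric.closedBall z r ∈ 𝓝[{z' : ℂ | 2 < z'.re ∧ z'.re < z.re}] z := mem_nhdsWithin_of_mem_nhds (Metric.closedBall_mem_nhds z hr0)
  -- Borel descent of every `Λ^T E(φ, z′)`, `Re z′ > 2`
  have hmeas : ∀ z' : ℂ, 2 < z'.re →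
      AEStronglyMeasurable ((quasiSplit (↥(maximalRealSubfield L)) L (IsCMField.complexConj L) 3).quotFun (truncation ν 𝓕 T (eisensteinSeriesU (flatSectionU φ z')))) μ :=
    fun z' hz' => (measurable_quotFun_of_measurable (measurable_truncation_eisensteinSeriesU_flatSectionU_cm_three' L ν 𝓕 hT hz' hφc hφM)
      (truncation_eisensteinSeriesU_flatSectionU_arithmeticSubgroup_mul ν h𝓕 T hφB z')).aestronglyMeasurable
  have key := integral_quotFun_mul_conj_eq_of_closure (quasiSplit (↥(maximalRealSubfield L)) L (IsCMField.complexConj L) 3) μ (mem_closure_subtube hz)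
    (Λ' := fun z' : ℂ => truncation ν 𝓕 T (eisensteinSeriesU (flatSectionU φ z')))
    (hmeas z hz) (hM₀ z (Metric.mem_closedBall_self hr0.le))
    (eventually_nhdsWithin_of_forall fun z' hz' => hmeas z' hz'.1)
    (by filter_upwards [hKcS] with z' hz'; exact hM₀ z' hz')
    hcont hR fun z' hz' => hrel z' hz'.1 hz'.2
  rw [integral_mul_conj_self_eq] at key
  exact key

end Diagonal

end Summit.HodgeConjecture.HodgeConjecture.Cruxes.H413.K2E1MaassSelbergDiagonalCMThree

end
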